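import Summits.QuantumAdvantage.QuantumAdvantage.Theorems.CubicForrelationNearExactIsExactTwelveOddWeightR4Rank

/-!
# Crux `CubicForrelation.NearExactIsExact` (stmt-QuantumAdvantage-14043) — n = 12, WEIGHT OF A TYPE-O CUBIC, V: the NORMAL FORM of a quadratic
  with `1536` ones — `q = D_{a₁}q · D_{a₀}q ⊕ D_{a₃}q · D_{a₂}q` for a symplectic frame `a₀,a₁,a₂,a₃`

Certificate seat `b2b-cforr-cert` (gen 32).  HONEST FRAMING: kernel-checked finite-slice lemmas (standard axioms) — Dickson's normal form for the
light derivative of case R4 of "a cubic Boolean function on 12 bits with weight `≡ 8 (mod 16)` has weight `≥ 1280`" (…TwelveOddWeight*).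
NOT summit progress; no value of `θ₁₂`.

For `q` of degree `≤ 2` on 12 bits with exactly `1536` ones, `B(x,y) = q(0) ⊕ q(x) ⊕ q(y) ⊕ q(x⊕y)`:
* `tow_R4_extract`: a symplectic frame — `B(a₀,a₁) = B(a₂,a₃) = 1`, the four cross values `0` (the radical has `256 < 4096` points, so some
  `a₀` is outside it; Gram–Schmidt inside the `1024`-point cell `B(·,a₀) = B(·,a₁) = 0`, which is larger than the radical).
* `tow_R4_formula`: for such a frame, `q(x) = (D_{a₁}q(x) ∧ D_{a₀}q(x)) ⊕ (D_{a₃}q(x) ∧ D_{a₂}q(x))` for EVERY `x`, where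
  `D_a q(x) = q(x) ⊕ q(x⊕a)` is affine [Taylor expansion at the radical component of `x` (`es_taylor_point`; the cell
  `{B(·,aⱼ) = 0 ∀ j}` has `256` points hence IS the radical, along which `q` is periodic), and the remaining constant is `0` because the
  other sign would give `2560` ones (`tow_card_bent_shift`)].
* `tow_R4_frame`: the package consumed by …TwelveOddWeightR4.

References: L. E. Dickson (1901); F. J. MacWilliams, N. J. A. Sloane (1977) Ch. 15 §2 Thm 4; C. Carlet (2021) §5.2.  Axioms: the standard three.
-/

set_option linter.dupNamespace false -- D-0017: single-problem summit ⇒ `QuantumAdvantage.QuantumAdvantage` by design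

noncomputable section

namespace Summit.QuantumAdvantage.QuantumAdvantage.Theorems.CubicForrelation.NearExactIsExact

open Finset
open Literature.Computability.QuantumComplexity
open Literature.Computability.QuantumComplexity.BuzetChailloux (bxor zeroVec bxor_bxor_cancel_left bxor_zeroVec zeroVec_bxor bxor_comm
  bxor_self twist_bxor_right twist_zeroVec_right sum_twist_left bxor_eq_zeroVec_iff)
open Literature.Computability.QuantumComplexity.DerivativeWalsh (W twist_bxor_left)
open Literature.Computability.QuantumComplexity.QuadSampler (rad)

/-! ### Small Boolean facts -/

/-- `B(b·a, y) = b ∧ B(a,y)` for a bit `b` (with `0·a = 0` and `B(0,y) = 0`). [folklore] -/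
theorem tow_B_smul {n : ℕ} (q : (Fin n → Bool) → Bool) (b : Bool) (a y : Fin n → Bool) :
    (q zeroVec ^^ q (fun j => b && a j) ^^ q y ^^ q (bxor (fun j => b && a j) y)) =
      (b && (q zeroVec ^^ q a ^^ q y ^^ q (bxor a y))) := by
  cases b
  · have e : (fun j => false && a j) = (zeroVec : Fin n → Bool) := by funext j; simp [zeroVec]
    rw [e, zeroVec_bxor]
    cases q zeroVec <;> cases q y <;> rfl
  · have e : (fun j => true && a j) = a := by funext j; simp
    rw [e, Bool.true_and]

/-- The Boolean identity behind the normal form: the Taylor coefficients versus the product of the derivatives, in the ten atoms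
`c = q 0`, `Y = q y`, `Pⱼ = q aⱼ`, `Aⱼ = q (y ⊕ aⱼ)`. [folklore] -/
theorem tow_bool_R4 : ∀ (c Y P₀ P₁ P₂ P₃ A₀ A₁ A₂ A₃ : Bool),
    (c ^^ ((c ^^ Y ^^ P₁ ^^ A₁) && (c ^^ P₀)) ^^ ((c ^^ Y ^^ P₀ ^^ A₀) && (c ^^ P₁)) ^^ ((c ^^ Y ^^ P₁ ^^ A₁) && (c ^^ Y ^^ P₀ ^^ A₀)) ^^
        ((c ^^ Y ^^ P₃ ^^ A₃) && (c ^^ P₂)) ^^ ((c ^^ Y ^^ P₂ ^^ A₂) && (c ^^ P₃)) ^^ ((c ^^ Y ^^ P₃ ^^ A₃) && (c ^^ Y ^^ P₂ ^^ A₂))) =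
      ((((Y ^^ A₁) && (Y ^^ A₀)) ^^ ((Y ^^ A₃) && (Y ^^ A₂))) ^^ (c ^^ ((c ^^ P₀) && (c ^^ P₁)) ^^ ((c ^^ P₂) && (c ^^ P₃)))) := by
  decide

/-- A shifted bent quadratic on `𝔽₂⁴` has exactly `6` ones. [cite: Carlet2020, §5.2] -/
theorem tow_card_bent_shift : ∀ (s₀ s₁ s₂ s₃ : Bool),
    #(univ.filter fun t : Fin 4 → Bool => (((t 0 ^^ s₀) && (t 1 ^^ s₁)) ^^ ((t 2 ^^ s₂) && (t 3 ^^ s₃))) = true) = 6 := by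
  decide

/-- … and its complement has `10`. [cite: Carlet2020, §5.2] -/
theorem tow_card_bent_shift_not : ∀ (s₀ s₁ s₂ s₃ : Bool),
    #(univ.filter fun t : Fin 4 → Bool => (!(((t 0 ^^ s₀) && (t 1 ^^ s₁)) ^^ ((t 2 ^^ s₂) && (t 3 ^^ s₃)))) = true) = 10 := by
  decide

/-- `∀ i : Fin 4` as a conjunction. [folklore] -/
private theorem tow_forall_fin4 (P : Fin 4 → Prop) : (∀ i, P i) ↔ P 0 ∧ P 1 ∧ P 2 ∧ P 3 := by
  constructor
  · intro h; exact ⟨h 0, h 1, h 2, h 3⟩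
  · rintro ⟨h0, h1, h2, h3⟩ i
    fin_cases i
    · exact h0
    · exact h1
    · exact h2
    · exact h3

/-! ### The symplectic frame -/

/-- **Symplectic extraction at rank 4.**  A quadratic `q` on 12 bits with `1536` ones admits `a₀,a₁,a₂,a₃` with `B(a₀,a₁) = B(a₂,a₃) = 1`
and `B(aᵢ,aⱼ) = 0` for the four cross pairs. [cite: MacWilliamsSloane1977, Ch. 15 §2 Thm 4] -/
theorem tow_R4_extract (q : (Fin (6 + 6) → Bool) → Bool) (hq : IsDegLeFun 2 q)
    (hw : #(univ.filter fun x : Fin (6 + 6) → Bool => q x = true) = 1536) :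
    ∃ a₀ a₁ a₂ a₃ : Fin (6 + 6) → Bool,
      (q zeroVec ^^ q a₀ ^^ q a₁ ^^ q (bxor a₀ a₁)) = true ∧ (q zeroVec ^^ q a₂ ^^ q a₃ ^^ q (bxor a₂ a₃)) = true ∧
      (q zeroVec ^^ q a₀ ^^ q a₂ ^^ q (bxor a₀ a₂)) = false ∧ (q zeroVec ^^ q a₀ ^^ q a₃ ^^ q (bxor a₀ a₃)) = false ∧
      (q zeroVec ^^ q a₁ ^^ q a₂ ^^ q (bxor a₁ a₂)) = false ∧ (q zeroVec ^^ q a₁ ^^ q a₃ ^^ q (bxor a₁ a₃)) = false := by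
  classical
  obtain ⟨hrad, -⟩ := tow_rank4_rad q hq hw
  have hsymm := es_B_symm q
  have hadd := es_B_add_left q hq
  -- a vector outside the radical and a partner
  obtain ⟨a₀, -, ha₀⟩ : ∃ a₀ ∈ (univ : Finset (Fin (6 + 6) → Bool)), a₀ ∉ rad q :=
    exists_mem_notMem_of_card_lt_card (by rw [hrad, card_univ, Fintype.card_fun, Fintype.card_bool, Fintype.card_fin]; norm_num)
  have hex : ∃ a₁, (q zeroVec ^^ q a₁ ^^ q a₀ ^^ q (bxor a₁ a₀)) = true := by
    by_contra hno
    push Not at hno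
    exact ha₀ ((tow_mem_rad_iff_B q hq a₀).2 fun x => by simpa using hno x)
  obtain ⟨a₁, h10⟩ := hex
  have h01 : (q zeroVec ^^ q a₀ ^^ q a₁ ^^ q (bxor a₀ a₁)) = true := by rw [hsymm]; exact h10
  have h00 := es_B_self q a₀
  have h11 := es_B_self q a₁
  -- the forms of `B(·,a₀)`, `B(·,a₁)` and the `1024`-point cell
  obtain ⟨c₀, hc₀⟩ := tow_B_form q hq a₀
  obtain ⟨c₁, hc₁⟩ := tow_B_form q hq a₁
  have hc₀' : ∀ x, decide (Odd #(univ.filter fun j => x j && c₀ j)) = (q zeroVec ^^ q x ^^ q a₀ ^^ q (bxor x a₀)) := fun x => (hc₀ x).symm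
  have hc₁' : ∀ x, decide (Odd #(univ.filter fun j => x j && c₁ j)) = (q zeroVec ^^ q x ^^ q a₁ ^^ q (bxor x a₁)) := fun x => (hc₁ x).symm
  set z2 : Fin 2 → Fin (6 + 6) → Bool := ![c₀, c₁] with hz2
  have hdual2 : ∀ i j : Fin 2, decide (Odd #(univ.filter fun l => (![a₁, a₀] : Fin 2 → Fin (6 + 6) → Bool) j l && z2 i l)) =
      decide (i = j) := by
    rw [Fin.forall_fin_two]
    refine ⟨?_, ?_⟩ <;> rw [Fin.forall_fin_two] <;> refine ⟨?_, ?_⟩ <;>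
      simp only [hz2, Matrix.cons_val_zero, Matrix.cons_val_one, hc₀', hc₁', h10, h00, h11, h01] <;> decide
  have hind2 := tow_indep_of_dual z2 ![a₁, a₀] hdual2
  have hW2 := tow_card_paritySet z2 (fun _ => false) hind2
  set W2 := univ.filter (fun x : Fin (6 + 6) → Bool => ∀ i, decide (Odd #(univ.filter fun j => x j && z2 i j)) = false) with hW2def
  have hW2card : #W2 = 1024 := by
    have e : (2 : ℕ) ^ (6 + 6) = 4096 := by norm_num
    have e2 : (2 : ℕ) ^ 2 = 4 := by norm_num
    rw [e, e2] at hW2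
    omega
  -- the radical lies inside the cell
  have hradW2 : rad q ⊆ W2 := by
    intro d hd
    have hB := (tow_mem_rad_iff_B q hq d).1 hd
    refine mem_filter.2 ⟨mem_univ _, fun i => ?_⟩
    fin_cases i
    · show decide (Odd #(univ.filter fun j => d j && c₀ j)) = false
      rw [← hc₀ d, hsymm]; exact hB a₀
    · show decide (Odd #(univ.filter fun j => d j && c₁ j)) = false
      rw [← hc₁ d, hsymm]; exact hB a₁
  obtain ⟨a₂, ha₂W, ha₂rad⟩ : ∃ a₂ ∈ W2, a₂ ∉ rad q :=
    exists_mem_notMem_of_card_lt_card (by rw [hrad, hW2card]; norm_num)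
  have h20 : (q zeroVec ^^ q a₂ ^^ q a₀ ^^ q (bxor a₂ a₀)) = false := by
    rw [hc₀ a₂]; exact (mem_filter.1 ha₂W).2 0
  have h21 : (q zeroVec ^^ q a₂ ^^ q a₁ ^^ q (bxor a₂ a₁)) = false := by
    rw [hc₁ a₂]; exact (mem_filter.1 ha₂W).2 1
  have hexb : ∃ b, (q zeroVec ^^ q b ^^ q a₂ ^^ q (bxor b a₂)) = true := by
    by_contra hno
    push Not at hno
    exact ha₂rad ((tow_mem_rad_iff_B q hq a₂).2 fun x => by simpa using hno x)
  obtain ⟨b, hb2⟩ := hexb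
  have h2b : (q zeroVec ^^ q a₂ ^^ q b ^^ q (bxor a₂ b)) = true := by rw [hsymm]; exact hb2
  have h02 : (q zeroVec ^^ q a₀ ^^ q a₂ ^^ q (bxor a₀ a₂)) = false := by rw [hsymm]; exact h20
  have h12 : (q zeroVec ^^ q a₁ ^^ q a₂ ^^ q (bxor a₁ a₂)) = false := by rw [hsymm]; exact h21
  -- symplectic Gram–Schmidt: correct `b` into the `B`-orthogonal complement of `⟨a₀, a₁⟩`
  cases hβ₁ : (q zeroVec ^^ q b ^^ q a₁ ^^ q (bxor b a₁)) <;> cases hβ₀ : (q zeroVec ^^ q b ^^ q a₀ ^^ q (bxor b a₀))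
  · refine ⟨a₀, a₁, a₂, b, h01, h2b, h02, ?_, h12, ?_⟩
    · rw [hsymm]; exact hβ₀
    · rw [hsymm]; exact hβ₁
  · refine ⟨a₀, a₁, a₂, bxor b a₁, h01, ?_, h02, ?_, h12, ?_⟩
    · rw [hsymm, hadd, hb2, h12]; decide
    · rw [hsymm, hadd, hβ₀, h10]; decide
    · rw [hsymm, hadd, hβ₁, h11]; decide
  · refine ⟨a₀, a₁, a₂, bxor b a₀, h01, ?_, h02, ?_, h12, ?_⟩
    · rw [hsymm, hadd, hb2, h02]; decide
    · rw [hsymm, hadd, hβ₀, h00]; decide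
    · rw [hsymm, hadd, hβ₁, h01]; decide
  · refine ⟨a₀, a₁, a₂, bxor (bxor b a₀) a₁, h01, ?_, h02, ?_, h12, ?_⟩
    · rw [hsymm, hadd, hadd, hb2, h02, h12]; decide
    · rw [hsymm, hadd, hadd, hβ₀, h00, h10]; decide
    · rw [hsymm, hadd, hadd, hβ₁, h01, h11]; decide

/-! ### The normal form -/

set_option maxHeartbeats 800000 in
/-- **Normal form of a quadratic with `1536` ones.**  For a symplectic frame as in `tow_R4_extract`:
`q(x) = (q(x) ⊕ q(x⊕a₁)) ∧ (q(x) ⊕ q(x⊕a₀)) ⊕ (q(x) ⊕ q(x⊕a₃)) ∧ (q(x) ⊕ q(x⊕a₂))` for every `x`.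
[cite: MacWilliamsSloane1977, Ch. 15 §2 Thm 4] -/
theorem tow_R4_formula (q : (Fin (6 + 6) → Bool) → Bool) (hq : IsDegLeFun 2 q)
    (hw : #(univ.filter fun x : Fin (6 + 6) → Bool => q x = true) = 1536) (a₀ a₁ a₂ a₃ : Fin (6 + 6) → Bool)
    (h01 : (q zeroVec ^^ q a₀ ^^ q a₁ ^^ q (bxor a₀ a₁)) = true) (h23 : (q zeroVec ^^ q a₂ ^^ q a₃ ^^ q (bxor a₂ a₃)) = true)
    (h02 : (q zeroVec ^^ q a₀ ^^ q a₂ ^^ q (bxor a₀ a₂)) = false) (h03 : (q zeroVec ^^ q a₀ ^^ q a₃ ^^ q (bxor a₀ a₃)) = false)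
    (h12 : (q zeroVec ^^ q a₁ ^^ q a₂ ^^ q (bxor a₁ a₂)) = false) (h13 : (q zeroVec ^^ q a₁ ^^ q a₃ ^^ q (bxor a₁ a₃)) = false)
    (x : Fin (6 + 6) → Bool) :
    q x = (((q x ^^ q (bxor x a₁)) && (q x ^^ q (bxor x a₀))) ^^ ((q x ^^ q (bxor x a₃)) && (q x ^^ q (bxor x a₂)))) := by
  classical
  obtain ⟨hrad, -⟩ := tow_rank4_rad q hq hw
  have hper := tow_rank4_periodic q hq hw
  have hsymm := es_B_symm q
  have hadd := es_B_add_left q hq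
  have h10 : (q zeroVec ^^ q a₁ ^^ q a₀ ^^ q (bxor a₁ a₀)) = true := by rw [hsymm]; exact h01
  have h32 : (q zeroVec ^^ q a₃ ^^ q a₂ ^^ q (bxor a₃ a₂)) = true := by rw [hsymm]; exact h23
  have h20 : (q zeroVec ^^ q a₂ ^^ q a₀ ^^ q (bxor a₂ a₀)) = false := by rw [hsymm]; exact h02
  have h30 : (q zeroVec ^^ q a₃ ^^ q a₀ ^^ q (bxor a₃ a₀)) = false := by rw [hsymm]; exact h03
  have h21 : (q zeroVec ^^ q a₂ ^^ q a₁ ^^ q (bxor a₂ a₁)) = false := by rw [hsymm]; exact h12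
  have h31 : (q zeroVec ^^ q a₃ ^^ q a₁ ^^ q (bxor a₃ a₁)) = false := by rw [hsymm]; exact h13
  have h00 := es_B_self q a₀; have h11 := es_B_self q a₁; have h22 := es_B_self q a₂; have h33 := es_B_self q a₃
  -- the four forms and the `256`-point cell, which is the radical
  obtain ⟨c₀, hc₀⟩ := tow_B_form q hq a₀
  obtain ⟨c₁, hc₁⟩ := tow_B_form q hq a₁
  obtain ⟨c₂, hc₂⟩ := tow_B_form q hq a₂
  obtain ⟨c₃, hc₃⟩ := tow_B_form q hq a₃
  have hc₀' : ∀ x, decide (Odd #(univ.filter fun j => x j && c₀ j)) = (q zeroVec ^^ q x ^^ q a₀ ^^ q (bxor x a₀)) := fun x => (hc₀ x).symm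
  have hc₁' : ∀ x, decide (Odd #(univ.filter fun j => x j && c₁ j)) = (q zeroVec ^^ q x ^^ q a₁ ^^ q (bxor x a₁)) := fun x => (hc₁ x).symm
  have hc₂' : ∀ x, decide (Odd #(univ.filter fun j => x j && c₂ j)) = (q zeroVec ^^ q x ^^ q a₂ ^^ q (bxor x a₂)) := fun x => (hc₂ x).symm
  have hc₃' : ∀ x, decide (Odd #(univ.filter fun j => x j && c₃ j)) = (q zeroVec ^^ q x ^^ q a₃ ^^ q (bxor x a₃)) := fun x => (hc₃ x).symm
  set z4 : Fin 4 → Fin (6 + 6) → Bool := ![c₀, c₁, c₂, c₃] with hz4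
  have hdual4 : ∀ i j : Fin 4, decide (Odd #(univ.filter fun l => (![a₁, a₀, a₃, a₂] : Fin 4 → Fin (6 + 6) → Bool) j l && z4 i l)) =
      decide (i = j) := by
    have ez0 : z4 0 = c₀ := rfl
    have ez1 : z4 1 = c₁ := rfl
    have ez2 : z4 2 = c₂ := rfl
    have ez3 : z4 3 = c₃ := rfl
    have ea0 : (![a₁, a₀, a₃, a₂] : Fin 4 → Fin (6 + 6) → Bool) 0 = a₁ := rfl
    have ea1 : (![a₁, a₀, a₃, a₂] : Fin 4 → Fin (6 + 6) → Bool) 1 = a₀ := rfl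
    have ea2 : (![a₁, a₀, a₃, a₂] : Fin 4 → Fin (6 + 6) → Bool) 2 = a₃ := rfl
    have ea3 : (![a₁, a₀, a₃, a₂] : Fin 4 → Fin (6 + 6) → Bool) 3 = a₂ := rfl
    rw [tow_forall_fin4]
    refine ⟨?_, ?_, ?_, ?_⟩ <;> rw [tow_forall_fin4] <;> refine ⟨?_, ?_, ?_, ?_⟩ <;>
      simp only [ez0, ez1, ez2, ez3, ea0, ea1, ea2, ea3, hc₀', hc₁', hc₂', hc₃', h10, h00, h30, h20, h01, h11, h31, h21, h12, h02, h32, h22,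
        h13, h03, h33, h23] <;> decide
  have hind4 := tow_indep_of_dual z4 ![a₁, a₀, a₃, a₂] hdual4
  set W4 := univ.filter (fun y : Fin (6 + 6) → Bool => ∀ i, decide (Odd #(univ.filter fun j => y j && z4 i j)) = false) with hW4def
  have hW4card : #W4 = 256 := by
    have h := tow_card_paritySet z4 (fun _ => false) hind4
    have e : (2 : ℕ) ^ (6 + 6) = 4096 := by norm_num
    have e4 : (2 : ℕ) ^ 4 = 16 := by norm_num
    rw [e, e4, ← hW4def] at h
    omega
  have hradW4 : rad q ⊆ W4 := by
    intro d hd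
    have hB := (tow_mem_rad_iff_B q hq d).1 hd
    refine mem_filter.2 ⟨mem_univ _, fun i => ?_⟩
    fin_cases i
    · show decide (Odd #(univ.filter fun j => d j && c₀ j)) = false
      rw [← hc₀ d, hsymm]; exact hB a₀
    · show decide (Odd #(univ.filter fun j => d j && c₁ j)) = false
      rw [← hc₁ d, hsymm]; exact hB a₁
    · show decide (Odd #(univ.filter fun j => d j && c₂ j)) = false
      rw [← hc₂ d, hsymm]; exact hB a₂
    · show decide (Odd #(univ.filter fun j => d j && c₃ j)) = false
      rw [← hc₃ d, hsymm]; exact hB a₃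
  have hW4rad : W4 = rad q := (eq_of_subset_of_card_le hradW4 (by rw [hrad, hW4card])).symm
  -- the radical component of a point and the Taylor expansion
  have key : ∀ y : Fin (6 + 6) → Bool,
      q y = (q zeroVec ^^ ((q zeroVec ^^ q y ^^ q a₁ ^^ q (bxor y a₁)) && (q zeroVec ^^ q a₀)) ^^
        ((q zeroVec ^^ q y ^^ q a₀ ^^ q (bxor y a₀)) && (q zeroVec ^^ q a₁)) ^^
        ((q zeroVec ^^ q y ^^ q a₁ ^^ q (bxor y a₁)) && (q zeroVec ^^ q y ^^ q a₀ ^^ q (bxor y a₀))) ^^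
        ((q zeroVec ^^ q y ^^ q a₃ ^^ q (bxor y a₃)) && (q zeroVec ^^ q a₂)) ^^
        ((q zeroVec ^^ q y ^^ q a₂ ^^ q (bxor y a₂)) && (q zeroVec ^^ q a₃)) ^^
        ((q zeroVec ^^ q y ^^ q a₃ ^^ q (bxor y a₃)) && (q zeroVec ^^ q y ^^ q a₂ ^^ q (bxor y a₂)))) := by
    intro y
    set ε : Fin 4 → Bool := ![(q zeroVec ^^ q y ^^ q a₁ ^^ q (bxor y a₁)), (q zeroVec ^^ q y ^^ q a₀ ^^ q (bxor y a₀)),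
      (q zeroVec ^^ q y ^^ q a₃ ^^ q (bxor y a₃)), (q zeroVec ^^ q y ^^ q a₂ ^^ q (bxor y a₂))] with hε
    have hε0 : ε 0 = (q zeroVec ^^ q y ^^ q a₁ ^^ q (bxor y a₁)) := rfl
    have hε1 : ε 1 = (q zeroVec ^^ q y ^^ q a₀ ^^ q (bxor y a₀)) := rfl
    have hε2 : ε 2 = (q zeroVec ^^ q y ^^ q a₃ ^^ q (bxor y a₃)) := rfl
    have hε3 : ε 3 = (q zeroVec ^^ q y ^^ q a₂ ^^ q (bxor y a₂)) := rfl
    set v : Fin (6 + 6) → Bool := fun j => y j ^^ ((ε 0 && a₀ j) ^^ (ε 1 && a₁ j) ^^ (ε 2 && a₂ j) ^^ (ε 3 && a₃ j)) with hv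
    have hyv : y = fun j => v j ^^ ((ε 0 && a₀ j) ^^ (ε 1 && a₁ j) ^^ (ε 2 && a₂ j) ^^ (ε 3 && a₃ j)) := by
      funext j; simp only [hv, Bool.xor_assoc, Bool.xor_self, Bool.xor_false]
    -- `v` lies in the cell `W4`, hence in the radical
    have hvB : ∀ (a : Fin (6 + 6) → Bool), (q zeroVec ^^ q v ^^ q a ^^ q (bxor v a)) =
        ((q zeroVec ^^ q y ^^ q a ^^ q (bxor y a)) ^^ (ε 0 && (q zeroVec ^^ q a₀ ^^ q a ^^ q (bxor a₀ a))) ^^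
          (ε 1 && (q zeroVec ^^ q a₁ ^^ q a ^^ q (bxor a₁ a))) ^^ (ε 2 && (q zeroVec ^^ q a₂ ^^ q a ^^ q (bxor a₂ a))) ^^
          (ε 3 && (q zeroVec ^^ q a₃ ^^ q a ^^ q (bxor a₃ a)))) := by
      intro a
      rw [hv, es_flatPt_bxor, hadd, hadd, hadd, hadd, tow_B_smul, tow_B_smul, tow_B_smul, tow_B_smul]
    have hvW : v ∈ W4 := by
      refine mem_filter.2 ⟨mem_univ _, fun i => ?_⟩
      fin_cases i
      · show decide (Odd #(univ.filter fun j => v j && c₀ j)) = false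
        rw [← hc₀ v, hvB a₀, h00, h10, h20, h30]
        simp only [hε0, hε1, Bool.and_false, Bool.and_true, Bool.xor_false]
        cases (q zeroVec ^^ q y ^^ q a₀ ^^ q (bxor y a₀)) <;> rfl
      · show decide (Odd #(univ.filter fun j => v j && c₁ j)) = false
        rw [← hc₁ v, hvB a₁, h01, h11, h21, h31]
        simp only [hε0, hε1, Bool.and_false, Bool.and_true, Bool.xor_false]
        cases (q zeroVec ^^ q y ^^ q a₁ ^^ q (bxor y a₁)) <;> rfl
      · show decide (Odd #(univ.filter fun j => v j && c₂ j)) = false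
        rw [← hc₂ v, hvB a₂, h02, h12, h22, h32]
        simp only [hε2, hε3, Bool.and_false, Bool.and_true, Bool.xor_false]
        cases (q zeroVec ^^ q y ^^ q a₂ ^^ q (bxor y a₂)) <;> rfl
      · show decide (Odd #(univ.filter fun j => v j && c₃ j)) = false
        rw [← hc₃ v, hvB a₃, h03, h13, h23, h33]
        simp only [hε2, hε3, Bool.and_false, Bool.and_true, Bool.xor_false]
        cases (q zeroVec ^^ q y ^^ q a₃ ^^ q (bxor y a₃)) <;> rfl
    have hvrad : v ∈ rad q := by rw [← hW4rad]; exact hvW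
    have hqv : q v = q zeroVec := by have := hper v hvrad zeroVec; rwa [zeroVec_bxor] at this
    have hqva : ∀ a : Fin (6 + 6) → Bool, q (bxor v a) = q a := fun a => by rw [bxor_comm]; exact hper v hvrad a
    have ht := es_taylor_point q hq a₀ a₁ a₂ a₃ h01 h23 h02 h03 h12 h13 v ε
    rw [← hyv, hqv, hqva, hqva, hqva, hqva, hε0, hε1, hε2, hε3] at ht
    exact ht
  -- hence `q = (product form) ⊕ e₀` with a constant `e₀`
  set e₀ : Bool := (q zeroVec ^^ ((q zeroVec ^^ q a₀) && (q zeroVec ^^ q a₁)) ^^ ((q zeroVec ^^ q a₂) && (q zeroVec ^^ q a₃))) with he₀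
  have key2 : ∀ y : Fin (6 + 6) → Bool, q y = ((((q y ^^ q (bxor y a₁)) && (q y ^^ q (bxor y a₀))) ^^
      ((q y ^^ q (bxor y a₃)) && (q y ^^ q (bxor y a₂)))) ^^ e₀) := by
    intro y
    refine (key y).trans ?_
    rw [he₀]
    exact tow_bool_R4 (q zeroVec) (q y) (q a₀) (q a₁) (q a₂) (q a₃) (q (bxor y a₀)) (q (bxor y a₁)) (q (bxor y a₂)) (q (bxor y a₃))
  -- the constant is `0`: otherwise `q` would have `2560` ones
  suffices he : e₀ = false by
    have h := key2 x
    rw [he, Bool.xor_false] at h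
    exact h
  by_contra hne
  have he : e₀ = true := by
    cases hv : e₀ with
    | true => rfl
    | false => exact absurd hv hne
  -- labels: `t(y) = (B(y,a₁) ⊕ s₀, B(y,a₀) ⊕ s₁, B(y,a₃) ⊕ s₂, B(y,a₂) ⊕ s₃)` through the forms `![c₁, c₀, c₃, c₂]`
  set zz : Fin 4 → Fin (6 + 6) → Bool := ![c₁, c₀, c₃, c₂] with hzz
  have hdualz : ∀ i j : Fin 4, decide (Odd #(univ.filter fun l => (![a₀, a₁, a₂, a₃] : Fin 4 → Fin (6 + 6) → Bool) j l && zz i l)) =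
      decide (i = j) := by
    have ez0 : zz 0 = c₁ := rfl
    have ez1 : zz 1 = c₀ := rfl
    have ez2 : zz 2 = c₃ := rfl
    have ez3 : zz 3 = c₂ := rfl
    have ea0 : (![a₀, a₁, a₂, a₃] : Fin 4 → Fin (6 + 6) → Bool) 0 = a₀ := rfl
    have ea1 : (![a₀, a₁, a₂, a₃] : Fin 4 → Fin (6 + 6) → Bool) 1 = a₁ := rfl
    have ea2 : (![a₀, a₁, a₂, a₃] : Fin 4 → Fin (6 + 6) → Bool) 2 = a₂ := rfl
    have ea3 : (![a₀, a₁, a₂, a₃] : Fin 4 → Fin (6 + 6) → Bool) 3 = a₃ := rfl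
    rw [tow_forall_fin4]
    refine ⟨?_, ?_, ?_, ?_⟩ <;> rw [tow_forall_fin4] <;> refine ⟨?_, ?_, ?_, ?_⟩ <;>
      simp only [ez0, ez1, ez2, ez3, ea0, ea1, ea2, ea3, hc₀', hc₁', hc₂', hc₃', h10, h00, h30, h20, h01, h11, h31, h21, h12, h02, h32, h22,
        h13, h03, h33, h23] <;> decide
  have hindz := tow_indep_of_dual zz ![a₀, a₁, a₂, a₃] hdualz
  set lab : (Fin (6 + 6) → Bool) → (Fin 4 → Bool) := fun y i => decide (Odd #(univ.filter fun j => y j && zz i j)) with hlab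
  have hfib : ∀ t : Fin 4 → Bool, #(univ.filter fun y : Fin (6 + 6) → Bool => lab y = t) = 256 := by
    intro t
    have h := tow_card_paritySet zz t hindz
    have e : (2 : ℕ) ^ (6 + 6) = 4096 := by norm_num
    have e4 : (2 : ℕ) ^ 4 = 16 := by norm_num
    rw [e, e4] at h
    have e2 : (univ.filter fun y : Fin (6 + 6) → Bool => lab y = t) =
        univ.filter fun y : Fin (6 + 6) → Bool => ∀ i, decide (Odd #(univ.filter fun j => y j && zz i j)) = t i :=
      filter_congr fun y _ => by simp only [hlab, funext_iff]
    rw [e2]; omega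
  -- `q` as a function of the label
  set s₀ := q zeroVec ^^ q a₁ with hs₀
  set s₁ := q zeroVec ^^ q a₀ with hs₁
  set s₂ := q zeroVec ^^ q a₃ with hs₂
  set s₃ := q zeroVec ^^ q a₂ with hs₃
  have hqlab : ∀ y, q y = !(((lab y 0 ^^ s₀) && (lab y 1 ^^ s₁)) ^^ ((lab y 2 ^^ s₂) && (lab y 3 ^^ s₃))) := by
    intro y
    rw [key2 y, he, Bool.xor_true]
    have l0 : lab y 0 = (q zeroVec ^^ q y ^^ q a₁ ^^ q (bxor y a₁)) := hc₁' y
    have l1 : lab y 1 = (q zeroVec ^^ q y ^^ q a₀ ^^ q (bxor y a₀)) := hc₀' y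
    have l2 : lab y 2 = (q zeroVec ^^ q y ^^ q a₃ ^^ q (bxor y a₃)) := hc₃' y
    have l3 : lab y 3 = (q zeroVec ^^ q y ^^ q a₂ ^^ q (bxor y a₂)) := hc₂' y
    rw [l0, l1, l2, l3, hs₀, hs₁, hs₂, hs₃]
    cases q zeroVec <;> cases q y <;> cases q a₀ <;> cases q a₁ <;> cases q a₂ <;> cases q a₃ <;> cases q (bxor y a₀) <;>
      cases q (bxor y a₁) <;> cases q (bxor y a₂) <;> cases q (bxor y a₃) <;> decide
  -- count through the fibres
  have hcount : #(univ.filter fun y : Fin (6 + 6) → Bool => q y = true) =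
      ∑ t : Fin 4 → Bool, #((univ.filter fun y : Fin (6 + 6) → Bool => q y = true).filter fun y => lab y = t) :=
    card_eq_sum_card_fiberwise fun _ _ => mem_univ _
  have hterm : ∀ t : Fin 4 → Bool, #((univ.filter fun y : Fin (6 + 6) → Bool => q y = true).filter fun y => lab y = t) =
      if (!(((t 0 ^^ s₀) && (t 1 ^^ s₁)) ^^ ((t 2 ^^ s₂) && (t 3 ^^ s₃)))) = true then 256 else 0 := by
    intro t
    rw [filter_filter]
    split_ifs with h
    · rw [← hfib t]
      exact congrArg card (filter_congr fun y _ => ⟨fun hy => hy.2, fun hy => ⟨by rw [hqlab y, hy]; exact h, hy⟩⟩)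
    · rw [card_eq_zero, filter_eq_empty_iff]
      rintro y - ⟨hq', hy⟩
      rw [hqlab y, hy] at hq'
      exact h hq'
  rw [hcount, sum_congr rfl fun t _ => hterm t, sum_ite, sum_const_zero, add_zero, sum_const, smul_eq_mul,
    tow_card_bent_shift_not] at hw
  norm_num at hw

/-- **The R4 frame (package).**  A quadratic `q` on 12 bits with exactly `1536` ones is the "product pair" of its own derivatives along a
symplectic frame: `q = D_{a₁}q · D_{a₀}q ⊕ D_{a₃}q · D_{a₂}q` with `B(a₀,a₁) = B(a₂,a₃) = 1` and the cross values `0`.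
[cite: MacWilliamsSloane1977, Ch. 15 §2 Thm 4] -/
theorem tow_R4_frame (q : (Fin (6 + 6) → Bool) → Bool) (hq : IsDegLeFun 2 q)
    (hw : #(univ.filter fun x : Fin (6 + 6) → Bool => q x = true) = 1536) :
    ∃ a₀ a₁ a₂ a₃ : Fin (6 + 6) → Bool,
      (q zeroVec ^^ q a₀ ^^ q a₁ ^^ q (bxor a₀ a₁)) = true ∧ (q zeroVec ^^ q a₂ ^^ q a₃ ^^ q (bxor a₂ a₃)) = true ∧
      (q zeroVec ^^ q a₀ ^^ q a₂ ^^ q (bxor a₀ a₂)) = false ∧ (q zeroVec ^^ q a₀ ^^ q a₃ ^^ q (bxor a₀ a₃)) = false ∧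
      (q zeroVec ^^ q a₁ ^^ q a₂ ^^ q (bxor a₁ a₂)) = false ∧ (q zeroVec ^^ q a₁ ^^ q a₃ ^^ q (bxor a₁ a₃)) = false ∧
      ∀ x, q x = (((q x ^^ q (bxor x a₁)) && (q x ^^ q (bxor x a₀))) ^^ ((q x ^^ q (bxor x a₃)) && (q x ^^ q (bxor x a₂)))) := by
  obtain ⟨a₀, a₁, a₂, a₃, h01, h23, h02, h03, h12, h13⟩ := tow_R4_extract q hq hw
  exact ⟨a₀, a₁, a₂, a₃, h01, h23, h02, h03, h12, h13, tow_R4_formula q hq hw a₀ a₁ a₂ a₃ h01 h23 h02 h03 h12 h13⟩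

end Summit.QuantumAdvantage.QuantumAdvantage.Theorems.CubicForrelation.NearExactIsExact

end
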